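import Literature.NumberTheory.GaloisRepresentations.ModPCyclotomicCharacterInertiaSurjective
import Literature.NumberTheory.GaloisRepresentations.OddAbsolutelyIrreducibleProofs
import Literature.NumberTheory.GaloisRepresentations.FrobeniusDivisionDensityProofs
import Literature.NumberTheory.GaloisRepresentations.HeckeCharacterProofs
import Literature.NumberTheory.GaloisRepresentations.TateLevelOneWildOdd
import Literature.NumberTheory.GaloisRepresentations.FramedRepBaseChange
import Literature.NumberTheory.Automorphic.AdicCompletionResidueCard
import HarnessLib

/-!
# Mod-`p` representations of `Γ_ℚ` known only through Frobenius polynomials `X² − a_ℓ X + ℓ`: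
# determinant, oddness, absolute irreducibility, a ramified inertia element

Topic `Literature/NumberTheory/GaloisRepresentations`; a *proofs* file (theorems only, no named
fact, no `sorry`; D-0026).  Several files of the tree hand a two-dimensional mod-`p`
representation `ρ̄ : Γ_ℚ → GL₂(𝔽_p)` (`ModPGaloisRep ℚ (ZMod p) 2`) downstream purely through its
Frobenius data "`charpoly ρ̄(Frob_ℓ) = X² − a_ℓ X + ℓ (mod p)` for the primes `ℓ ∤ T`" (e.g. the
torsion representation `ρ̄_{E,p}` of an elliptic curve with `a_ℓ = a_ℓ(E)`, `T = p N_E`: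
`IsTorsionGaloisRep.charpoly_eq_of_isArithFrobAt`; the named fact
`EllipticCurves.normImage_modThree_serreWeight_le_four` of the TQMP organ quantifies over such a
`ρ̄`).  This file derives, from that datum ALONE, the standing hypotheses of Serre's conjecture /
Edixhoven's weight bound (`Automorphic.edixhoven1992_serreWeight_le_weight_of_newform`,
`Automorphic.serreWeight_le_add_one_of_weightTwo_newform`):

* `FramedRep.isIrreducible_of_forall_submodule` — the "no stable line" phrasing of irreducibility
  (`∀ L ≤ 𝔽_pⁿ` stable, `L = ⊥ ∨ L = ⊤`) gives `FramedRep.IsIrreducible` (Mathlib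
  `Representation.IsIrreducible`, an `IsSimpleOrder` of subrepresentations);
* `ModPGaloisRep.det_eq_modNCyclotomicCharacter_of_frobCharpoly` — **`det ρ̄ = χ̄_p`**, the mod-`p`
  cyclotomic character: both continuous characters take the value `ℓ` at every arithmetic
  Frobenius above `ℓ ∤ T` (`Matrix.det_eq_of_charpoly_eq`;
  `modNCyclotomicCharacter_eq_residueCard_of_isArithFrobAt`, Neukirch I (10.3)), hence agree
  (Frobenius' density theorem, PROVED in the tree: `absoluteGaloisGroup.monoidHom_eq_of_frobenius'`);
* `ModPGaloisRep.isOdd_of_frobCharpoly` — hence **`ρ̄` is odd**: `χ̄_p(c) = −1`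
  (`modNCyclotomicCharacter_of_isComplexConjugation`);
* `ModPGaloisRep.isAbsolutelyIrreducible_of_frobCharpoly`,
  `ModPGaloisRep.isIrreducible_baseChange_of_frobCharpoly` — for `p ≠ 2`, irreducible + odd ⇒
  **absolutely irreducible** (Darmon–Diamond–Taylor 1995, Thm. 3.1 (b)–(c), p. 87:
  `FramedGaloisRep.IsOdd.isAbsolutelyIrreducible`), so every base change `ρ̄ ⊗_j k` is irreducible;
* `ModPGaloisRep.exists_mem_absInertia_det_ne_one_of_frobCharpoly` — for `p ≠ 2` and the place
  `v ∣ p` of `ℚ` there is `σ` in the inertia group of `ℚ_v` with `det ρ̄(σ) ≠ 1`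
  (`χ̄_p(I_{ℚ_p}) = 𝔽_pˣ`, Serre *Local Fields* IV §4 Prop. 17–18:
  `Rat.exists_mem_absInertia_adicCompletion_modPCyclotomicCharacterZMod_eq`) — Edixhoven's
  "non-exceptional" hypothesis `hdet` of `serreWeight_le_add_one_of_weightTwo_newform`;
* `ModPGaloisRep.exists_localRestrictionAt_det_ne_one_of_frobCharpoly` — packaged: for every
  algebraically closed `k` of characteristic `p` and `j : 𝔽_p → k`, a local restriction datum
  `loc` at `p` for `ρ̄ ⊗_j k` (the completion `ℚ_v`, `v ∣ p`; cf.
  `Automorphic.nonempty_localRestrictionAt`), a residue embedding `ι`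
  (`Automorphic.nonempty_ringHom_residue`), and `σ ∈ I_{loc.F}` with `det(loc.rep σ) ≠ 1`.

## References

* J.-P. Serre, *Sur les représentations modulaires de degré 2 de Gal(ℚ̄/ℚ)*, Duke Math. J. 54
  (1987), §1.1–1.2 (`det ρ̄`, oddness), §2.1 (the place above `p`). [Serre1987]
* H. Darmon, F. Diamond, R. Taylor, *Fermat's Last Theorem* (1995), Thm. 3.1 (b),(c) and p. 87.
  [DarmonDiamondTaylor1995]
* J.-P. Serre, *Local Fields*, GTM 67 (1979), Ch. IV §4, Prop. 17–18. [SerreLocalFields1979]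
* J. Neukirch, *Algebraic Number Theory* (1999), Ch. I (10.3). [NeukirchANT1999]
-/

noncomputable section

open scoped MatrixGroups NumberField Polynomial
open IsDedekindDomain Field Polynomial Rat.HeightOneSpectrum ValuativeRel

namespace Literature.NumberTheory.GaloisRepresentations

/-! ### Irreducibility from "no stable subspace" -/

section Irreducible

variable {G : Type*} [Group G] [TopologicalSpace G] {A : Type*} [Field A] [TopologicalSpace A]
  {n : ℕ}

/-- **"No proper non-zero stable subspace" is irreducibility.**  If every `A`-submodule
`L ≤ Aⁿ` stable under all the matrices `ρ g` is `⊥` or `⊤` (and `n ≠ 0`), the framed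
representation `ρ` is irreducible (`FramedRep.IsIrreducible`, i.e. Mathlib's
`Representation.IsIrreducible`: the lattice of subrepresentations is simple) — the definition of
an irreducible (simple) representation, Curtis–Reiner §10 p. 41 ("`M` is irreducible if `M ≠ 0`
and `M` contains no submodules other than `0` and `M`"); Serre, *Linear Representations* §1.3.
[cite: CurtisReiner1962, §10 (p. 41), Def. of irreducible module]
[cite: SerreLinearRepresentations1977, §1.3] -/
theorem FramedRep.isIrreducible_of_forall_submodule [NeZero n] (ρ : FramedRep G A n)
    (h : ∀ L : Submodule A (Fin n → A),
      (∀ (g : G) (x : Fin n → A), x ∈ L →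
        ((ρ g : GL (Fin n) A) : Matrix (Fin n) (Fin n) A).mulVec x ∈ L) → L = ⊥ ∨ L = ⊤) :
    ρ.IsIrreducible := by
  have hbot : (⊥ : Subrepresentation ρ.toRepresentation).toSubmodule = ⊥ := rfl
  have htop : (⊤ : Subrepresentation ρ.toRepresentation).toSubmodule = ⊤ := rfl
  haveI : Nontrivial (Subrepresentation ρ.toRepresentation) :=
    ⟨⟨⊥, ⊤, fun h' ↦ bot_ne_top ((hbot.symm.trans (congrArg Subrepresentation.toSubmodule h')).trans
      htop)⟩⟩
  refine ⟨fun W ↦ ?_⟩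
  have hW : ∀ (g : G) (x : Fin n → A), x ∈ W.toSubmodule →
      ((ρ g : GL (Fin n) A) : Matrix (Fin n) (Fin n) A).mulVec x ∈ W.toSubmodule := by
    intro g x hx
    have h1 := W.apply_mem_toSubmodule g hx
    rwa [FramedRep.toRepresentation_apply_apply] at h1
  rcases h W.toSubmodule hW with hb | ht
  · left
    exact Subrepresentation.toSubmodule_injective (hb.trans hbot.symm)
  · right
    exact Subrepresentation.toSubmodule_injective (ht.trans htop.symm)

end Irreducible

/-! ### Mod-`p` representations of `Γ_ℚ` with Frobenius polynomials `X² − a_ℓ X + ℓ` -/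

section Frob

variable {p : ℕ} [Fact p.Prime]

/-- The set of finite places of `ℚ` dividing a non-zero `T` is finite. [folklore] -/
private theorem finite_setOf_primesEquiv_dvd' {T : ℕ} (hT : T ≠ 0) :
    {v : HeightOneSpectrum (𝓞 ℚ) | ((primesEquiv v : Nat.Primes) : ℕ) ∣ T}.Finite := by
  have hfin : {n : ℕ | n ∣ T}.Finite :=
    T.divisors.finite_toSet.subset fun n hn ↦ Nat.mem_divisors.mpr ⟨hn, hT⟩
  exact (hfin.preimage (f := fun v : HeightOneSpectrum (𝓞 ℚ) ↦ ((primesEquiv v : Nat.Primes) : ℕ))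
    fun _ _ _ _ h ↦ primesEquiv.injective (Subtype.ext h)).subset fun v hv ↦ hv

/-- **`det ρ̄ = χ̄_p` from the Frobenius polynomials** (Serre 1987, §1.2; Frobenius/Chebotarev
density).  Let `ρ̄ : Γ_ℚ → GL₂(𝔽_p)` be continuous with `charpoly ρ̄(Frob) = X² − a_ℓ X + ℓ` at
every arithmetic Frobenius above the primes `ℓ ∤ T` (`T ≠ 0`, `p ∣ T`).  Then
`det ρ̄(σ) = χ̄_p(σ)` for EVERY `σ ∈ Γ_ℚ` (`χ̄_p = modNCyclotomicCharacter ℚ p`): the two continuous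
characters `Γ_ℚ → 𝔽_pˣ` agree at every arithmetic Frobenius above `ℓ ∤ T` — `det ρ̄(Frob_ℓ) = ℓ`
(`Matrix.det_eq_of_charpoly_eq`) and `χ̄_p(Frob_ℓ) = ℓ` (`p ∤ ℓ`; Neukirch I (10.3),
`modNCyclotomicCharacter_eq_residueCard_of_isArithFrobAt`) — hence everywhere
(`absoluteGaloisGroup.monoidHom_eq_of_frobenius'`, proved in the tree).
[cite: Serre1987, §1.2] [cite: NeukirchANT1999, Ch. I (10.3)] -/
theorem ModPGaloisRep.det_eq_modNCyclotomicCharacter_of_frobCharpoly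
    (ρ : ModPGaloisRep ℚ (ZMod p) 2) {T : ℕ} (hT : T ≠ 0) (hpT : p ∣ T) (a : ℕ → ℤ)
    (htr : ∀ (v : HeightOneSpectrum (𝓞 ℚ)), ¬ ((primesEquiv v : Nat.Primes) : ℕ) ∣ T →
      ∀ 𝔓 ∈ v.primesAbove, ∀ φ : absoluteGaloisGroup ℚ, IsArithFrobAt (𝓞 ℚ) φ 𝔓 →
        ((ρ φ : GL (Fin 2) (ZMod p)) : Matrix (Fin 2) (Fin 2) (ZMod p)).charpoly =
          X ^ 2 - C ((a ((primesEquiv v : Nat.Primes) : ℕ) : ℤ) : ZMod p) * X +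
            C ((((primesEquiv v : Nat.Primes) : ℕ) : ℕ) : ZMod p))
    (σ : absoluteGaloisGroup ℚ) :
    Matrix.GeneralLinearGroup.det (ρ σ) = modNCyclotomicCharacter ℚ p σ := by
  classical
  have hp : p.Prime := Fact.out
  set χ₁ : absoluteGaloisGroup ℚ →* (ZMod p)ˣ :=
    (Matrix.GeneralLinearGroup.det (n := Fin 2) (R := ZMod p)).comp ρ.toMonoidHom with hχ₁
  have hχ₁apply : ∀ τ, χ₁ τ = Matrix.GeneralLinearGroup.det (ρ τ) := fun _ ↦ rfl
  -- continuity of the two characters (through the injection `𝔽_pˣ → 𝔽_p`)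
  have hinj : Function.Injective (fun u : (ZMod p)ˣ ↦ (u : ZMod p)) := Units.val_injective
  have hc₁ : Continuous ((fun u : (ZMod p)ˣ ↦ (u : ZMod p)) ∘ χ₁) := by
    have h : ((fun u : (ZMod p)ˣ ↦ (u : ZMod p)) ∘ χ₁) =
        fun τ ↦ ((ρ τ : GL (Fin 2) (ZMod p)) : Matrix (Fin 2) (Fin 2) (ZMod p)).det := by
      funext τ
      simp only [Function.comp_apply, hχ₁apply, Matrix.GeneralLinearGroup.val_det_apply]
    rw [h]
    exact (Units.continuous_val.comp (map_continuous ρ)).matrix_det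
  have hc₂ : Continuous ((fun u : (ZMod p)ˣ ↦ (u : ZMod p)) ∘ modNCyclotomicCharacter ℚ p) :=
    continuous_comp_modNCyclotomicCharacter ℚ p fun u : (ZMod p)ˣ ↦ (u : ZMod p)
  -- agreement at the good Frobenii
  have hagree : ∀ v ∉ {v : HeightOneSpectrum (𝓞 ℚ) | ((primesEquiv v : Nat.Primes) : ℕ) ∣ T},
      ∀ 𝔓 ∈ v.primesAbove, ∀ Φ : absoluteGaloisGroup ℚ, IsArithFrobAt (𝓞 ℚ) Φ 𝔓 →
        χ₁ Φ = modNCyclotomicCharacter ℚ p Φ := by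
    intro v hv 𝔓 h𝔓 Φ hΦ
    haveI : 𝔓.IsPrime := h𝔓.1
    set ℓ : ℕ := ((primesEquiv v : Nat.Primes) : ℕ) with hℓdef
    have hℓ : ℓ.Prime := (primesEquiv v).2
    have hℓT : ¬ ℓ ∣ T := hv
    have hℓp : ¬ ℓ ∣ p := fun h ↦ hℓT (((Nat.prime_dvd_prime_iff_eq hℓ hp).mp h) ▸ hpT)
    have hpP : ((p : ℕ) : absIntegers (𝓞 ℚ) ℚ) ∉ 𝔓 :=
      Rat.natCast_not_mem_of_mem_primesAbove_of_not_dvd h𝔓 hℓp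
    apply Units.ext
    rw [hχ₁apply, Matrix.GeneralLinearGroup.val_det_apply,
      Matrix.det_eq_of_charpoly_eq (htr v hℓT 𝔓 h𝔓 Φ hΦ),
      modNCyclotomicCharacter_eq_residueCard_of_isArithFrobAt h𝔓 hpP hΦ,
      Rat.residueCard_eq_natGenerator]
    rfl
  have heq := absoluteGaloisGroup.monoidHom_eq_of_frobenius' hinj
    (finite_setOf_primesEquiv_dvd' hT) hc₁ hc₂ hagree
  rw [← hχ₁apply, heq]

/-- **`ρ̄` is odd** (`det ρ̄(c) = −1` for every complex conjugation `c`), for `ρ̄ : Γ_ℚ → GL₂(𝔽_p)`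
with Frobenius polynomials `X² − a_ℓ X + ℓ` off `T` (`p ∣ T ≠ 0`): `det ρ̄ = χ̄_p`
(`det_eq_modNCyclotomicCharacter_of_frobCharpoly`) and `χ̄_p(c) = −1`
(`modNCyclotomicCharacter_of_isComplexConjugation`).  Serre 1987, §1.1–1.2 ("`ρ` impaire").
[cite: Serre1987, §1.1–1.2] -/
theorem ModPGaloisRep.isOdd_of_frobCharpoly
    (ρ : ModPGaloisRep ℚ (ZMod p) 2) {T : ℕ} (hT : T ≠ 0) (hpT : p ∣ T) (a : ℕ → ℤ)
    (htr : ∀ (v : HeightOneSpectrum (𝓞 ℚ)), ¬ ((primesEquiv v : Nat.Primes) : ℕ) ∣ T →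
      ∀ 𝔓 ∈ v.primesAbove, ∀ φ : absoluteGaloisGroup ℚ, IsArithFrobAt (𝓞 ℚ) φ 𝔓 →
        ((ρ φ : GL (Fin 2) (ZMod p)) : Matrix (Fin 2) (Fin 2) (ZMod p)).charpoly =
          X ^ 2 - C ((a ((primesEquiv v : Nat.Primes) : ℕ) : ℤ) : ZMod p) * X +
            C ((((primesEquiv v : Nat.Primes) : ℕ) : ℕ) : ZMod p)) :
    FramedGaloisRep.IsOdd ρ := by
  intro φ c hc
  rw [ModPGaloisRep.det_eq_modNCyclotomicCharacter_of_frobCharpoly ρ hT hpT a htr c]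
  apply Units.ext
  rw [modNCyclotomicCharacter_of_isComplexConjugation (N := p) hc, Units.val_neg, Units.val_one]

/-- `2 ≠ 0` in `𝔽_p` for an odd prime `p`. [folklore] -/
private theorem two_ne_zero_zmod' (hp2 : p ≠ 2) : (2 : ZMod p) ≠ 0 := by
  have hp : p.Prime := Fact.out
  intro h
  have h' : ((2 : ℕ) : ZMod p) = 0 := by exact_mod_cast h
  rw [ZMod.natCast_eq_zero_iff] at h'
  exact hp2 ((Nat.prime_dvd_prime_iff_eq hp Nat.prime_two).mp h')

/-- **Irreducible + Frobenius polynomials `X² − a_ℓ X + ℓ` ⇒ absolutely irreducible** (`p ≠ 2`).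
For `ρ̄ : Γ_ℚ → GL₂(𝔽_p)` with no proper non-zero stable `𝔽_p`-line and Frobenius data as
above: `ρ̄` is odd (`isOdd_of_frobCharpoly`), and an odd irreducible plane representation in
characteristic `≠ 2` is absolutely irreducible (Darmon–Diamond–Taylor 1995, Thm. 3.1 (b)–(c) and
p. 87; the tree's `FramedGaloisRep.IsOdd.isAbsolutelyIrreducible` at the real place of `ℚ`).
[cite: DarmonDiamondTaylor1995, Thm. 3.1 (b)–(c) and p. 87] -/
theorem ModPGaloisRep.isAbsolutelyIrreducible_of_frobCharpoly (hp2 : p ≠ 2)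
    (ρ : ModPGaloisRep ℚ (ZMod p) 2)
    (hirr : ∀ L : Submodule (ZMod p) (Fin 2 → ZMod p),
      (∀ (g : absoluteGaloisGroup ℚ) (x : Fin 2 → ZMod p), x ∈ L →
        ((ρ g : GL (Fin 2) (ZMod p)) : Matrix (Fin 2) (Fin 2) (ZMod p)).mulVec x ∈ L) →
        L = ⊥ ∨ L = ⊤)
    {T : ℕ} (hT : T ≠ 0) (hpT : p ∣ T) (a : ℕ → ℤ)
    (htr : ∀ (v : HeightOneSpectrum (𝓞 ℚ)), ¬ ((primesEquiv v : Nat.Primes) : ℕ) ∣ T →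
      ∀ 𝔓 ∈ v.primesAbove, ∀ φ : absoluteGaloisGroup ℚ, IsArithFrobAt (𝓞 ℚ) φ 𝔓 →
        ((ρ φ : GL (Fin 2) (ZMod p)) : Matrix (Fin 2) (Fin 2) (ZMod p)).charpoly =
          X ^ 2 - C ((a ((primesEquiv v : Nat.Primes) : ℕ) : ℤ) : ZMod p) * X +
            C ((((primesEquiv v : Nat.Primes) : ℕ) : ℕ) : ZMod p)) :
    FramedRep.IsAbsolutelyIrreducible ρ :=
  FramedGaloisRep.IsOdd.isAbsolutelyIrreducible (Rat.castHom ℝ)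
    (ModPGaloisRep.isOdd_of_frobCharpoly ρ hT hpT a htr)
    (FramedRep.isIrreducible_of_forall_submodule ρ hirr) (two_ne_zero_zmod' hp2)

/-- **Every base change `ρ̄ ⊗_j k` is irreducible** (`p ≠ 2`; `k` any field, `j : 𝔽_p → k`
continuous), for `ρ̄` irreducible with Frobenius polynomials `X² − a_ℓ X + ℓ` off `T` —
`isAbsolutelyIrreducible_of_frobCharpoly` unfolded at `j` (`FramedRep.toRepresentation_baseChange`).
The hypothesis `hirr` of `Automorphic.serreWeight_le_add_one_of_weightTwo_newform` for `ρ̄ ⊗_j k`.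
[cite: DarmonDiamondTaylor1995, Thm. 3.1 (b)–(c) and p. 87] -/
theorem ModPGaloisRep.isIrreducible_baseChange_of_frobCharpoly (hp2 : p ≠ 2)
    (ρ : ModPGaloisRep ℚ (ZMod p) 2)
    (hirr : ∀ L : Submodule (ZMod p) (Fin 2 → ZMod p),
      (∀ (g : absoluteGaloisGroup ℚ) (x : Fin 2 → ZMod p), x ∈ L →
        ((ρ g : GL (Fin 2) (ZMod p)) : Matrix (Fin 2) (Fin 2) (ZMod p)).mulVec x ∈ L) →
        L = ⊥ ∨ L = ⊤)
    {T : ℕ} (hT : T ≠ 0) (hpT : p ∣ T) (a : ℕ → ℤ)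
    (htr : ∀ (v : HeightOneSpectrum (𝓞 ℚ)), ¬ ((primesEquiv v : Nat.Primes) : ℕ) ∣ T →
      ∀ 𝔓 ∈ v.primesAbove, ∀ φ : absoluteGaloisGroup ℚ, IsArithFrobAt (𝓞 ℚ) φ 𝔓 →
        ((ρ φ : GL (Fin 2) (ZMod p)) : Matrix (Fin 2) (Fin 2) (ZMod p)).charpoly =
          X ^ 2 - C ((a ((primesEquiv v : Nat.Primes) : ℕ) : ℤ) : ZMod p) * X +
            C ((((primesEquiv v : Nat.Primes) : ℕ) : ℕ) : ZMod p))
    {k : Type} [Field k] [TopologicalSpace k] [IsTopologicalRing k] (j : ZMod p →+* k)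
    (hj : Continuous j) :
    (FramedGaloisRep.toGaloisRep (K := ℚ) (FramedRep.baseChange j hj ρ)).IsIrreducible :=
  ModPGaloisRep.isAbsolutelyIrreducible_of_frobCharpoly hp2 ρ hirr hT hpT a htr k j

/-- **An inertia element at `p` on which `det ρ̄` is non-trivial** (`p ≠ 2`).  For `ρ̄` with
Frobenius polynomials `X² − a_ℓ X + ℓ` off `T` (`p ∣ T ≠ 0`) and the place `v ∣ p` of `ℚ`, there
is `σ` in the absolute inertia group of `ℚ_v = v.adicCompletion ℚ` with
`det ρ̄(σ|_ℚ̄) ≠ 1`: `det ρ̄ = χ̄_p` (`det_eq_modNCyclotomicCharacter_of_frobCharpoly`), `χ̄_p` is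
compatible with restriction to `Γ_{ℚ_v}` (`modNCyclotomicCharacter_absGaloisRestrict`), and
`χ̄_p(I_{ℚ_v}) = 𝔽_pˣ ∋ −1 ≠ 1` (Serre, *Local Fields*, IV §4, Prop. 17–18:
`Rat.exists_mem_absInertia_adicCompletion_modPCyclotomicCharacterZMod_eq`).  This is the
"non-exceptional" hypothesis of Edixhoven's weight bound.
[cite: SerreLocalFields1979, Ch. IV §4, Prop. 17 (ii)(iii) and Prop. 18 (pp. 77–78)]
[cite: Serre1987, §1.2 and §2.1] -/
theorem ModPGaloisRep.exists_mem_absInertia_det_ne_one_of_frobCharpoly (hp2 : p ≠ 2)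
    (ρ : ModPGaloisRep ℚ (ZMod p) 2) {T : ℕ} (hT : T ≠ 0) (hpT : p ∣ T) (a : ℕ → ℤ)
    (htr : ∀ (v : HeightOneSpectrum (𝓞 ℚ)), ¬ ((primesEquiv v : Nat.Primes) : ℕ) ∣ T →
      ∀ 𝔓 ∈ v.primesAbove, ∀ φ : absoluteGaloisGroup ℚ, IsArithFrobAt (𝓞 ℚ) φ 𝔓 →
        ((ρ φ : GL (Fin 2) (ZMod p)) : Matrix (Fin 2) (Fin 2) (ZMod p)).charpoly =
          X ^ 2 - C ((a ((primesEquiv v : Nat.Primes) : ℕ) : ℤ) : ZMod p) * X +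
            C ((((primesEquiv v : Nat.Primes) : ℕ) : ℕ) : ZMod p))
    (v : HeightOneSpectrum (𝓞 ℚ)) (hv : ((primesEquiv v : Nat.Primes) : ℕ) = p) :
    ∃ σ ∈ absInertia (v.adicCompletion ℚ),
      Matrix.GeneralLinearGroup.det (ρ (absGaloisRestrict ℚ (v.adicCompletion ℚ) σ)) ≠ 1 := by
  have hp : p.Prime := Fact.out
  -- (no `CharZero (ℚ_v)` INSTANCE is put in scope: it would let `absGaloisRestrict ℚ ℚ_v` pick up
  -- `DivisionRing.toRatAlgebra` instead of the completion's own `ℚ`-algebra structure)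
  haveI : NeZero ((p : ℕ) : v.adicCompletion ℚ) := ⟨by
    have hcz : CharZero (v.adicCompletion ℚ) :=
      charZero_of_injective_algebraMap (algebraMap ℚ (v.adicCompletion ℚ)).injective
    exact_mod_cast hp.ne_zero⟩
  haveI : Fact (2 < p) := ⟨lt_of_le_of_ne hp.two_le (Ne.symm hp2)⟩
  obtain ⟨σ, hσ, hχ⟩ :=
    Rat.exists_mem_absInertia_adicCompletion_modPCyclotomicCharacterZMod_eq v hv (-1)
  refine ⟨σ, hσ, ?_⟩
  -- `det ρ̄ = χ̄_p` at `σ|_ℚ̄`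
  have hdet := ModPGaloisRep.det_eq_modNCyclotomicCharacter_of_frobCharpoly ρ hT hpT a htr
    (absGaloisRestrict ℚ (v.adicCompletion ℚ) σ)
  -- `χ̄_p` of `ℚ` at `σ|_ℚ̄` is `χ̄_p` of `ℚ_v` at `σ` (independent of the `ℚ`-algebra structure)
  have hres : modNCyclotomicCharacter ℚ p (absGaloisRestrict ℚ (v.adicCompletion ℚ) σ) =
      modPCyclotomicCharacterZMod (v.adicCompletion ℚ) p σ := by
    rw [modPCyclotomicCharacterZMod_eq_modNCyclotomicCharacter]
    convert modNCyclotomicCharacter_absGaloisRestrict ℚ (v.adicCompletion ℚ) p σ using 2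
  have h1 : Matrix.GeneralLinearGroup.det (ρ (absGaloisRestrict ℚ (v.adicCompletion ℚ) σ)) = -1 :=
    hdet.trans (hres.trans hχ)
  intro h
  exact ZMod.neg_one_ne_one (n := p) (by simpa [Units.ext_iff] using h1.symm.trans h)

/-- **A local restriction datum at `p` for `ρ̄ ⊗_j k` with a ramified determinant** (`p ≠ 2`).
For `ρ̄ : Γ_ℚ → GL₂(𝔽_p)` with Frobenius polynomials `X² − a_ℓ X + ℓ` off `T` (`p ∣ T ≠ 0`), an
algebraically closed field `k` of characteristic `p` (discrete) and `j : 𝔽_p → k`: there are a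
local restriction datum `loc` at `p` for the base change `ρ̄ ⊗_j k` — the completion `ℚ_v` at the
place `v ∣ p` with `rep = (ρ̄ ⊗_j k)|_{Γ_{ℚ_v}}` (`q_v = p`:
`Automorphic.residueFieldCard_adicCompletion_eq`; uniformiser `p`:
`Automorphic.irreducible_natCast_valuativeInteger_adicCompletion`; cf.
`Automorphic.nonempty_localRestrictionAt`) —, a residue embedding `ι`
(`Automorphic.nonempty_ringHom_residue`), and `σ ∈ I_{loc.F}` with `det(loc.rep σ) ≠ 1`
(`exists_mem_absInertia_det_ne_one_of_frobCharpoly`; `det` commutes with `GL₂(j)` and `j` is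
injective).  Serre 1987, §2.1 (the choice of a place above `p`).
[cite: Serre1987, §2.1] [cite: SerreLocalFields1979, Ch. IV §4, Prop. 17–18 (pp. 77–78)] -/
theorem ModPGaloisRep.exists_localRestrictionAt_det_ne_one_of_frobCharpoly (hp2 : p ≠ 2)
    (ρ : ModPGaloisRep ℚ (ZMod p) 2) {T : ℕ} (hT : T ≠ 0) (hpT : p ∣ T) (a : ℕ → ℤ)
    (htr : ∀ (v : HeightOneSpectrum (𝓞 ℚ)), ¬ ((primesEquiv v : Nat.Primes) : ℕ) ∣ T →
      ∀ 𝔓 ∈ v.primesAbove, ∀ φ : absoluteGaloisGroup ℚ, IsArithFrobAt (𝓞 ℚ) φ 𝔓 →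
        ((ρ φ : GL (Fin 2) (ZMod p)) : Matrix (Fin 2) (Fin 2) (ZMod p)).charpoly =
          X ^ 2 - C ((a ((primesEquiv v : Nat.Primes) : ℕ) : ℤ) : ZMod p) * X +
            C ((((primesEquiv v : Nat.Primes) : ℕ) : ℕ) : ZMod p))
    (k : Type) [Field k] [TopologicalSpace k] [DiscreteTopology k] [CharP k p] [IsAlgClosed k]
    (j : ZMod p →+* k) (hj : Continuous j) :
    ∃ (loc : ModPGaloisRep.LocalRestrictionAt p (FramedRep.baseChange j hj ρ))
      (_ : absIntegers 𝒪[loc.F] loc.F ⧸ IsNonarchimedeanLocalField.absMaximalIdeal loc.F →+* k),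
      ∃ σ ∈ absInertia loc.F, Matrix.GeneralLinearGroup.det (loc.rep σ) ≠ 1 := by
  have hp : p.Prime := Fact.out
  set v : HeightOneSpectrum (𝓞 ℚ) := (primesEquiv (R := 𝓞 ℚ)).symm ⟨p, hp⟩ with hvdef
  have hpv : ((primesEquiv v : Nat.Primes) : ℕ) = p :=
    congrArg Subtype.val ((primesEquiv (R := 𝓞 ℚ)).apply_symm_apply ⟨p, hp⟩)
  have hq : IsNonarchimedeanLocalField.residueFieldCard (v.adicCompletion ℚ) = p := by
    rw [Literature.NumberTheory.Automorphic.residueFieldCard_adicCompletion_eq,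
      Rat.residueCard_eq_natGenerator, ← hpv]
    rfl
  have hirr : Irreducible ((p : ℕ) : 𝒪[v.adicCompletion ℚ]) := by
    have h := Literature.NumberTheory.Automorphic.irreducible_natCast_valuativeInteger_adicCompletion v
    rwa [hpv] at h
  let loc : ModPGaloisRep.LocalRestrictionAt p (FramedRep.baseChange j hj ρ) :=
    { F := v.adicCompletion ℚ
      residueFieldCard_eq := hq
      irreducible_natCast := hirr
      rep := FramedGaloisRep.restrictField (v.adicCompletion ℚ) (FramedRep.baseChange j hj ρ)
      rep_eq_restrictField := rfl }
  obtain ⟨ι⟩ := Literature.NumberTheory.Automorphic.nonempty_ringHom_residue (k := k) p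
    (v.adicCompletion ℚ) hq
  obtain ⟨σ, hσ, hdet⟩ :=
    ModPGaloisRep.exists_mem_absInertia_det_ne_one_of_frobCharpoly hp2 ρ hT hpT a htr v hpv
  refine ⟨loc, ι, σ, hσ, ?_⟩
  -- `det (GL₂(j) M) = j (det M)` and `j` is injective
  have hrep : loc.rep σ =
      Matrix.GeneralLinearGroup.map j (ρ (absGaloisRestrict ℚ (v.adicCompletion ℚ) σ)) := by
    rw [ModPGaloisRep.LocalRestrictionAt.rep_apply]
    rfl
  intro h1
  apply hdet
  apply Units.ext
  apply j.injective
  have h2 := congrArg (fun u : kˣ ↦ (u : k)) h1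
  simp only [hrep, Matrix.GeneralLinearGroup.val_det_apply, Units.val_one] at h2
  rw [Matrix.GeneralLinearGroup.val_det_apply, Units.val_one, map_one]
  rw [← h2]
  change j _ = (((ρ (absGaloisRestrict ℚ (v.adicCompletion ℚ) σ) : GL (Fin 2) (ZMod p)) :
    Matrix (Fin 2) (Fin 2) (ZMod p)).map j).det
  rw [RingHom.map_det, RingHom.mapMatrix_apply]

end Frob

end Literature.NumberTheory.GaloisRepresentations

end
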